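import Summits.BirchSwinnertonDyer.Rank1Residual.F1Sign2.DescentSignAtTwo
import Summits.BirchSwinnertonDyer.Rank1Residual.F1Sign2.EggLemmaAtTwo
import Literature.NumberTheory.EllipticCurves.HeegnerPoints
import Literature.NumberTheory.EllipticCurves.MazurTateTamePairing
import HarnessLib

/-!
# Cell `bsd-f1-sign2`, lens `-an` g7 (MEMO-an v1.17 §2 AN-22K): THE TRANSPOSITION DOOR AT `Δ < 0` — T-q₀ `TranspositionTwistLawAtTwo`
# (theorem on paper) and AN-22K `TranspositionDoorLawAtTwo` (conjecture), with the carriers `TranspAdmissible` / `MeetsNonNormAt` / `OnTranspLocus`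

STATEMENTS ONLY (definitions with bodies `TranspAdmissible`, `MeetsNonNormAt`, `OnTranspLocus`; the candidate THEOREM T-q₀ `TranspositionTwistLawAtTwo`
as a plain `def … : Prop` (in-print assembly: Mazur–Rubin 2010 Prop. 3.3 at `T = {q₀}` + Kramer 1981 Prop. 3 — nothing asserted); the lens' CONJECTURE
AN-22K `TranspositionDoorLawAtTwo` as `@[conjecture] def` (open obligation, nothing asserted); two bookkeeping theorems PROVED in-file; no named
Literature fact, no `sorry`).

TYPER FILING (seat `bsd-f1-sign2-ty` g4, D-an-22; CANDIDATES.md rows T-q₀ / AN-22K / D-an-TA / D-an-NN / P-22): bodies VERBATIM from the planner's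
`HOME/MEMO-an-data/g7/Sketch_v12.lean` fc676d9cd895c7f3 (-an g7 2026-08-28T01:24:08Z, MEMO-an v1.17 15d5a678cd33dab8, rows `CANDIDATES-rows-an-v117.md`
4733921bb5de65b1; lean rc 0 / 0 err / 0 warn / 0 sorry per -an; evidence #20 on stmt-BirchSwinnertonDyer-23715); namespace as in the sketch
(`Summit.BirchSwinnertonDyer.Rank1Residual.F1Sign2.TranspositionDoor`); edits = this header and exactly two token-level changes, both recorded here:
(1) `@[conjecture]` added on `TranspositionDoorLawAtTwo` (the cell's filing convention: a lens CONJECTURE is an `@[conjecture] def` open obligation;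
T-q₀, a theorem on paper, stays a plain `def` like IMC-LKε); (2) cite key `Gross1991` (interim stub entry) ↦ `GrossLMS1991` (Gross, «Kolyvagin's work on
modular elliptic curves», LMS LN 153 — the entry the docstring's «Conj. 1.2 and §3» means; same normalisation as `ArchReciprocityAtTwo.lean` p590539).
Census of record (planner's, quoted): kit j296070 (57 s) + j296119 (171 s), ENGINE H, `MEMO-an-data/g7/jobH/`: 1 340 #1-optimal rank-1 odd-torsion curves
N < 1 500 (1 066 with Δ < 0), Heegner d ∈ [−199, −7] → 2 215 rows / 1 766 certified: MR/T-q₀ law **1 504/1 504** (bit 1 ⇒ s₂(E^d) = 0: 1 337; bit 0 ⇒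
s₂ = 2: 167); **AN-22K 465/465** (non-norm ∧ I_K odd 421; norm ∧ I_K even 44; good/mult/add at 2: 175/146/144); P-22 identity 1 766/1 766; two-engine
superset j295949 running at filing time. REF1-AUDIT-v1 §54 (cc2bab5972100320, 2026-08-28T01:31:18Z, D-an-24 ANSWERED; evidence `HOME/REF1-data/b52/` Probe_V12.lean 52f19aab087c48e2, BC7_b52.txt 1c956565b43e9c3f): Sketch_v12 fc676d9cd895c7f3 rc 0 / 0 sorry / axioms standard; **T-q₀ `TranspositionTwistLawAtTwo` SURVIVES THEOREM-GRADE** (= Mazur–Rubin 2010 Prop. 3.3 [arXiv p0008 quoted] with `T = {q₀}`: `Δ < 0` ⇒ no real-place condition, verbatim; the parity clause pins `d` in both branches ⇒ `#Sel₂(E^{(d)}) = 1 / 4`, no ambiguity; Kramer 1981 Prop. 3 p. 125 page-verified for the non-norm coset); **AN-22K `TranspositionDoorLawAtTwo` SURVIVES conjecture-grade**, BC7 CLEAN ×2 (P1/P2/P2h ok; P3 ok on AN-22K); `MeetsNonNormAt` junk-safe (`reducePointAt` junk = Õ ∈ 2Ẽ can only fail to witness; odd torsion reduces into 2Ẽ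 ⇒ `∃ P` ⟺ `loc_{q₀} δ(P₀) ≠ 0`); the `[W.IsIntegral ℤ]` binders are REDUNDANT (`inferInstance` from `IsGloballyMinimal.isIntegral_int`, Prop-class) — harmless, kept verbatim; `Δ < 0` redundant mod G2 given `TranspAdmissible` (reciprocity) — harmless, kept; inhabited (43a1, −7, 7; guards by `decide`/`norm_num`); 0 killed; «-ty cleared to port as `F1Sign2/TranspositionDoorAtTwo.lean`». REF2-PLACEMENT v16 §42 (67f3de45ad038de2, 2026-08-28T01:25:37Z; MEMO-an v1.17 placed; supersedes §39 (b) on v1.16): **T-q₀ `TranspositionTwistLawAtTwo` = IN PRINT (theorem), grade KNOWN** — Mazur–Rubin 2010 Prop. 3.3 at `T = {q₀}` [corpus: paper:arxiv-0904.3709 p0008 L54–110] + Kramer 1981 Prop. 3 [p0006 L45–47] («`K/F` ramified, odd residue characteristic, good reduction ⇒ `i(K/F) = dim Ẽ(k)[2]`; `i` even or odd according to `(Δ,d)_F = ±1`», proof: `E(F)/N E(K) ≅ Ẽ(k)/2Ẽ(k)`) — so `MeetsNonNormAt` IS Kramer's non-norm coset verbatim and «transposition ⟺ `i_{q₀} =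 1`» is Prop. 3's second sentence; `loc_{q₀} δP ≠ 0 ⟺ P̃ ∉ 2Ẽ(k)` (formal group 2-divisible) closes the assembly with no gap; cites for the typer: [MazurRubin2010, Prop. 3.3] = SOURCE of T-q₀, [Kramer1981, Prop. 3] on `MeetsNonNormAt` (both carried by the sketch's docstrings, kept verbatim); **AN-22K `TranspositionDoorLawAtTwo` = conjecture, NOT IN PRINT, NEW-COMBINATION — planner's self-grade AGREED** (AN-21-LAW family with `∞ ↦ q₀`; nearest print, none stating it: Kriz–Li 2019 Thm 1.12-type (`a_ℓ` odd only), Cai–Li–Zhai 2020 / CLTZ 2015 (even `a_q`, rank-0 base, `ℤ/2`-torsion), Jetchev 2008 (Heegner index vs Tamagawa, odd `p`), Gross's `K`-level formula 2-part open); BC5 = 465/465, P-22 1 766/1 766. PARTITION: none moved; beyond-print theorem: no. bears_on: `stmt-BirchSwinnertonDyer-23715`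
(the `Δ < 0` residual of the line `egg_kolyvagin_two`, D-an-26) and `stmt-BirchSwinnertonDyer-19099`.

Planner's summary (verbatim): # Sketch v12 (-an g7, MEMO-an v1.16 AN-22K): THE TRANSPOSITION DOOR AT `Δ < 0`

At `Δ_W < 0` complex conjugation acts on `W[2]` as a transposition, `H¹(ℝ, W[2]) = 0`, and there is no
archimedean sign object (no egg).  Hilbert reciprocity (AN-22J, `ArchReciprocityAtTwo.lean`) forces every
Heegner-type `d ≡ 1 (8)` to carry an ODD number of *transposition primes* `q ∣ d` (`(Δ/q) = −1`, `Ẽ(𝔽_q)[2] ≅ ℤ/2`).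
For a MINIMALLY RAMIFIED Heegner field (exactly one transposition prime `q₀`, `a_q` odd at the other `q ∣ d`)
Kramer's local-norm class of the generator at `q₀` — «`P mod q₀ ∉ 2Ẽ(𝔽_{q₀})`», since
`E(ℚ_{q₀})/N E(K_𝔮₀) = Ẽ(𝔽_{q₀})/2Ẽ(𝔽_{q₀})` at a ramified good odd prime — replaces the egg bit:

* `TranspositionTwistLawAtTwo` (THEOREM on paper = Mazur–Rubin 2010 Prop. 3.3 with `T = {q₀}` + Kramer 1981
  Prop. 3; the `Δ < 0` twin of -desc's T-C `EggTwistLawAtTwo`): rank one, `Ш[2] = 0`, `E(ℚ)[2] = 0`, `Δ < 0`: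
  `#Sel₂(E^{(d)}) = 1` if `E(ℚ)` meets the non-norm coset at `q₀`, `= 4` otherwise.
* `TranspositionDoorLawAtTwo` (CONJECTURE AN-22K, the `Δ < 0` twin of the egg-locus law AN-21-LAW / AN-13′):
  with odd Tamagawa product in addition, the Heegner point over `K` is NOT twice up to torsion iff `E(ℚ)` meets
  the non-norm coset at `q₀` (⟺ `I_K` odd ⟺, by the BSD₂-shadow P-22, `Ш_an(E^{(d)})` odd).
Census: kit j295427 (ENGINE F = ENGINE E on `Δ < 0`, pre-registered).  Nothing is asserted; defs only + one triviality.
LANDING NOTE (-ty g12, 2026-08-28T19:5xZ): T-q₀ `TranspositionTwistLawAtTwo` is a TREE THEOREM — `GenusKolyTransp.transpositionTwistLawAtTwo_holds` (gk2-p4 g13, p660700); see its docstring.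
-/


noncomputable section

open scoped Classical

namespace Summit.BirchSwinnertonDyer.Rank1Residual.F1Sign2.TranspositionDoor

open Literature.NumberTheory.EllipticCurves Literature.NumberTheory.EllipticCurves.ModularForms
  Summit.BirchSwinnertonDyer.Rank1Residual.F1Sign2

set_option autoImplicit false

/-- **Transposition-admissible (minimally ramified Heegner) twist parameter at `Δ < 0`.**  `d < 0` squarefree,
`d ≡ 1 (mod 8)`; `q₀ ∣ d` is a prime of good reduction at which Frobenius acts on `W[2]` as a transposition
(`(Δ_min/q₀) = −1`: the `2`-division cubic has exactly one root mod `q₀`); every other prime `q ∣ d` is good with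
`a_q(W)` odd (no root); `d` is a square modulo every odd bad prime (Heegner hypothesis; `W^{(d)} ≅ W` over `ℚ_ℓ`).
By AN-22J such `d` exist only when `Δ_W < 0` (the number of transposition primes is odd there, even at `Δ_W > 0`). -/
def TranspAdmissible (W : WeierstrassCurve ℚ) [W.IsGloballyMinimal] (d : ℤ) (q₀ : ℕ) : Prop :=
  d < 0 ∧ Squarefree d ∧ d % 8 = 1 ∧ q₀.Prime ∧ (q₀ : ℤ) ∣ d ∧ jacobiSym W.Δ.num q₀ = -1 ∧
    (∀ q : ℕ, q.Prime → (q : ℤ) ∣ d →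
      (∀ _h : Fact q.Prime, W.HasGoodReductionAtPrime q) ∧ (q ≠ q₀ → Odd (W.frobeniusTrace q))) ∧
    (∀ ℓ : ℕ, ℓ.Prime → ℓ ≠ 2 → (∀ _h : Fact ℓ.Prime, ¬ W.HasGoodReductionAtPrime ℓ) → jacobiSym d ℓ = 1)

/-- **`E(ℚ)` meets the non-norm coset at `q`**: some rational point reduces modulo `q` OUTSIDE `2·Ẽ(k_q)`
(tree `reducePointAt`; ⟺ `E(ℚ) → E(ℚ_q)/N_{K_w/ℚ_q} E(K_w) ≅ Ẽ(k_q)/2Ẽ(k_q)` is onto for `K_w/ℚ_q` ramified quadratic,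
`q` odd of good reduction — Kramer 1981 Prop. 3).  The `Δ < 0` analogue of -desc's `MeetsEgg`
(`E(ℚ) → E(ℝ)/N_{ℂ/ℝ}E(ℂ) = E(ℝ)/E⁰(ℝ)` onto). [cite: Kramer1981, Prop. 3] -/
def MeetsNonNormAt (W : WeierstrassCurve ℚ) [W.IsIntegral ℤ] (q : ℕ) [Fact q.Prime] : Prop :=
  ∃ P : W.toAffine.Point, ∀ Q : (reductionAtPrime W q).toAffine.Point, reducePointAt W q P ≠ 2 • Q

/-- **T-q₀ `TranspositionTwistLawAtTwo` (THEOREM on paper: Mazur–Rubin 2010 Prop. 3.3 with `K = ℚ`, `F = ℚ(√d)`,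
`T = {q₀}`, `dim H¹_f(ℚ_{q₀}, W[2]) = dim W(ℚ_{q₀})[2] = 1`, `V_T = loc_{q₀} Sel₂(W)`; the hypotheses of Prop. 3.3 hold:
the primes of `N` and `2` split, and at `Δ_W < 0` there is NO condition at the real place).**  Rank one, `Ш[2] = 0`,
`E(ℚ)[2] = 0`, `Δ < 0`, `(d, q₀)` transposition-admissible: `Sel₂(W) = ⟨δ(P)⟩` and
`#Sel₂(W^{(d)}) = 1` if `loc_{q₀} δ(P) ≠ 0` (`P mod q₀ ∉ 2Ẽ`), `#Sel₂(W^{(d)}) = 4` if `loc_{q₀} δ(P) = 0`.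
The `Δ < 0` twin of T-C `EggTwistLawAtTwo`. Census: kit j295427 (pre-registered).
LANDING NOTE (-ty g12, 2026-08-28): PROVED in the kernel with NO hypothesis left —
`Summit.BirchSwinnertonDyer.BirchSwinnertonDyer.Theorems.GenusKolyTransp.transpositionTwistLawAtTwo_holds : TranspositionTwistLawAtTwo`
(`Theorems/GenusKolyvaginAtTwoGenusPrimitiveSupplyAtTwoTranspositionTwistLaw.lean`, bsd-line-gk2-p4 g13, p660700 ACCEPTED, commit 7c15cbc1337a;
Mazur–Rubin 2010 Cor. 3.4 (i) at `T = {q₀}` via `natCard_selmerGroup_twist_directed_of_menu_frame` + the lead's `#E(ℚ_{q₀})[2] = 2` at a transposition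
prime + the Kummer reading `meetsNonNormAt_iff_exists_localization_ne_zero` (p660142); PT, Tate χ, Lemmas 2.10–2.11, frame and Kramer's congruence are
tree theorems; std axioms).  Users' `(h : TranspositionTwistLawAtTwo)` binders are fed that theorem; this `def` stays as the binder name (append-only).
[cite: MazurRubin2010, Prop. 3.3] [cite: Kramer1981, Prop. 3] -/
def TranspositionTwistLawAtTwo : Prop :=
  ∀ (W : WeierstrassCurve ℚ) [W.IsElliptic] [W.IsGloballyMinimal] [W.IsIntegral ℤ], W.Δ < 0 → NoRationalTwoTorsion W →
    W.mordellWeilRank = 1 → ShaTwoTrivial W →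
    ∀ (d : ℤ) (q₀ : ℕ) [Fact q₀.Prime], TranspAdmissible W d q₀ →
      (MeetsNonNormAt W q₀ → twistSelmerTwoCard W d = 1) ∧ (¬ MeetsNonNormAt W q₀ → twistSelmerTwoCard W d = 4)

/-- The transposition locus with odd Tamagawa product (the `Δ < 0` twin of `OnEggLocus`). -/
def OnTranspLocus (W : WeierstrassCurve ℚ) [W.IsElliptic] [W.IsIntegral ℤ] (q₀ : ℕ) [Fact q₀.Prime] : Prop :=
  W.Δ < 0 ∧ NoRationalTwoTorsion W ∧ ShaTwoTrivial W ∧ MeetsNonNormAt W q₀ ∧ ¬ 2 ∣ W.tamagawaProduct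

/-- **AN-22K `TranspositionDoorLawAtTwo` (CONJECTURE of this lens at `Δ < 0`; Kolyvagin's `c(1) ≢ 0 (mod 2)` read at
the transposition prime instead of the real place).**  Rank one, `E(ℚ)[2] = 0`, `Ш(E)[2] = 0`, `∏ c_ℓ` odd, `Δ < 0`,
`K` imaginary quadratic with `(d_K, q₀)` transposition-admissible, a modular parametrisation datum with ODD constant and
`P ∈ E(K)` mapping to its complex Heegner point: `P ∉ 2E(K) + E(K)_tors` (⟺ the Heegner index `I_K` is odd) **iff**
`E(ℚ)` meets the non-norm coset at `q₀`.  BSD₂-shadow (P-22, from the tree door `P2.shaAn_eq_heegnerIndexFormula_two`,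
`c_{q₀}(E^{(d)}) = 2`): `v₂ #Ш_an(E^{(d_K)}) = 2·v₂ I_K`, so the law says `Ш_an(E^{(d_K)})` is odd exactly on the
non-norm branch — where T-q₀ gives `Sel₂(E^{(d_K)}) = 0`: the rank-0, `Sel₂`-trivial half of BSD₂ for the twist, as on the egg.
Why it might fail: at `2` the Kolyvagin-system argument has no published structure theorem; the converse half (norm branch
⇒ `I_K` even) leans on `Ш(E/K)[2] ≅ (ℤ/2)²` being matched by `4 ∣ I_K²` with no Cassels–Tate subtlety at `2`.
Census: kit j295427 (pre-registered: `I_K odd ⟺ normbit = 1` on {Ш_an(E) odd, Tam odd, one transposition prime}).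
[cite: GrossLMS1991, Conj. 1.2 and §3] [cite: MazurRubin2010, Prop. 3.3] [cite: KrizLi2019, Lemma 5.4, Rem. 1.14] -/
@[conjecture] def TranspositionDoorLawAtTwo : Prop :=
  ∀ (W : WeierstrassCurve ℚ) [W.IsElliptic] [W.IsGloballyMinimal] [W.IsIntegral ℤ] [NeZero (W.conductorNorm ℤ)],
    W.mordellWeilRank = 1 → W.Δ < 0 → NoRationalTwoTorsion W → ShaTwoTrivial W → ¬ 2 ∣ W.tamagawaProduct →
    ∀ (q₀ : ℕ) [Fact q₀.Prime] (K : Type) [Field K] [NumberField K], IsImaginaryQuadratic K →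
      TranspAdmissible W (NumberField.discr K) q₀ →
      ∀ (Dt : ModularParametrizationData W (W.conductorNorm ℤ))
        (H : HeegnerDatum (W.conductorNorm ℤ) (NumberField.discr K)) (ι : K →+* ℂ)
        (P : (W.baseChange K).toAffine.Point),
        WeierstrassCurve.Affine.Point.map ι.toRatAlgHom P = heegnerPointComplex Dt H →
        ¬ (2 : ℤ) ∣ Dt.c → (NotTwiceUpToTorsion W K P ↔ MeetsNonNormAt W q₀)

/-- Bookkeeping (proved): on the transposition locus the door law gives the «not twice» conclusion of Kolyvagin type. -/
theorem notTwice_of_doorLaw (hL : TranspositionDoorLawAtTwo)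
    (W : WeierstrassCurve ℚ) [W.IsElliptic] [W.IsGloballyMinimal] [W.IsIntegral ℤ] [NeZero (W.conductorNorm ℤ)]
    (hr : W.mordellWeilRank = 1) (q₀ : ℕ) [Fact q₀.Prime] (hloc : OnTranspLocus W q₀)
    (K : Type) [Field K] [NumberField K] (hK : IsImaginaryQuadratic K)
    (hadm : TranspAdmissible W (NumberField.discr K) q₀)
    (Dt : ModularParametrizationData W (W.conductorNorm ℤ))
    (H : HeegnerDatum (W.conductorNorm ℤ) (NumberField.discr K)) (ι : K →+* ℂ)
    (P : (W.baseChange K).toAffine.Point)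
    (hP : WeierstrassCurve.Affine.Point.map ι.toRatAlgHom P = heegnerPointComplex Dt H) (hc : ¬ (2 : ℤ) ∣ Dt.c) :
    NotTwiceUpToTorsion W K P :=
  (hL W hr hloc.1 hloc.2.1 hloc.2.2.1 hloc.2.2.2.2 q₀ K hK hadm Dt H ι P hP hc).mpr hloc.2.2.2.1

/-- Sanity (proved): a transposition-admissible pair has `d < 0` and `q₀ ∣ d` prime — the datum is not vacuous by shape;
inhabited instances: `(43a1, d = −7, q₀ = 7)` (census j295427 self-test). -/
theorem transpAdmissible_neg {W : WeierstrassCurve ℚ} [W.IsGloballyMinimal] {d : ℤ} {q₀ : ℕ}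
    (h : TranspAdmissible W d q₀) : d < 0 ∧ q₀.Prime ∧ (q₀ : ℤ) ∣ d := ⟨h.1, h.2.2.2.1, h.2.2.2.2.1⟩

end Summit.BirchSwinnertonDyer.Rank1Residual.F1Sign2.TranspositionDoor

end
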